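import Literature.NumberTheory.Automorphic.LanglandsParameters
import Literature.NumberTheory.Automorphic.JordanDecompositionAlgGroup
import Literature.NumberTheory.GaloisRepresentations.LocalGaloisGroupProofs
import HarnessLib

/-!
# Discharge of `isUnramified_iff_of_gl`: unramified L-parameters of `GL_n` are semisimple
# conjugacy classes

D-0014 keeps `Literature/` sorry-free by stating cited results as named facts `def X : Prop`.
This sibling file of `Literature.NumberTheory.Automorphic.LanglandsParameters` proves its named
fact `isUnramified_iff_of_gl F n` (lang.S14; Borel, Corvallis 1979, §§8.2, 9.5, 10.4; Gross–Reeder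
2010, §3.1): an L-parameter `φ` of `LGroupData.gl F n` is unramified (trivial on inertia, trivial
`SL₂`) iff it is unramified with Frobenius eigenvalues `α` for some multiset `α`
(`LParameter.IsUnramifiedWith`, `SatakeParametersGL.lean`: for every `w ∈ W_F` of degree `1` the
matrix `φ(w)` is conjugate to `diag(d)` with `{d_j} = α`).

The printed argument ("the forward direction is Frobenius-semisimplicity of `φ`,
diagonalisability of semisimple complex matrices") formalised:

* for an unramified `φ` the `GL_n(ℂ)`-component `φ(w).left` is the SAME for all `w` of degree `1`
  (`left_φ_eq_of_deg_eq_one_of_isUnramified`): two such elements differ by an element of inertia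
  (`WeilGroup.deg_mul`, `deg_inv`, `deg_eq_zero_iff_mem_inertia`, with the discharged
  `IsFrobPow.mul_holds` / `IsFrobPow.unique_holds`), on which `φ` is the canonical section, and
  the Galois action on `Ĝ` is trivial for `gl`;
* `φ(w).left` is a semisimple element of `GL_n(ℂ)` (`isSemisimple_φ_of_gl`, the
  Frobenius-semisimplicity axiom of `LParameter` with `m = 1`), hence diagonalisable
  (`IsSemisimpleElt.exists_conj_diagonal`, Springer LAG 2.4.2 (ii), `JordanDecompositionAlgGroup.lean`):
  `P φ(w) P⁻¹ = diag(d)`, i.e. `φ(w) = P⁻¹ diag(d) P`; take `α = {d_j}`;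
* the converse is the elementary `isUnramified_of_isUnramifiedWith` of `LanglandsParameters.lean`.

## References

* A. Borel, *Automorphic L-functions*, Proc. Sympos. Pure Math. 33 (Corvallis 1979), Part 2,
  §§8.2, 9.5, 10.4. [Corvallis1979]
* B. Gross, M. Reeder, *Arithmetic invariants of discrete Langlands parameters*, Duke Math. J.
  154 (2010), §3.1. [GrossReeder2010]
* T. A. Springer, *Linear Algebraic Groups*, 2nd ed. (1998), 2.4.2 (ii). [SpringerLAG1998]
-/

noncomputable section

open scoped MatrixGroups

namespace Literature.NumberTheory.Automorphic

namespace LParameter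

variable {F : Type*} [Field F] [ValuativeRel F] [TopologicalSpace F] [IsNonarchimedeanLocalField F]
variable {n : ℕ}

/-- For an unramified L-parameter of `GL_n` (canonical section on inertia; trivial Galois action on
`Ĝ`), the `GL_n(ℂ)`-component of `φ(u w)` equals that of `φ(w)` for `u ∈ I_F`.
Ref: Borel, Corvallis 1979, §§8.2, 9.5. [cite: Corvallis1979, §9.5] -/
theorem left_φ_inertia_mul_of_isUnramified {φ : LParameter (LGroupData.gl F n)}
    (hφ : φ.IsUnramified) {u : GaloisRepresentations.WeilGroup F}
    (hu : u ∈ GaloisRepresentations.WeilGroup.inertia F) (w : GaloisRepresentations.WeilGroup F) :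
    (φ.φ (u * w)).left = (φ.φ w).left := by
  have hga : (LGroupData.gl F n).galAct = 1 := LGroupData.isSplit_gl n
  rw [map_mul, hφ.1 u hu]
  simp [SemidirectProduct.mul_left, hga]

/-- **For an unramified L-parameter of `GL_n`, `φ(w).left` does not depend on the degree-`1`
element `w`**: two elements of degree `1` differ by an element of inertia
(`WeilGroup.deg_eq_zero_iff_mem_inertia`, with the discharged facts `IsFrobPow.mul_holds`,
`IsFrobPow.unique_holds`).  Ref: Borel, Corvallis 1979, §9.5. [cite: Corvallis1979, §9.5] -/
theorem left_φ_eq_of_deg_eq_one_of_isUnramified {φ : LParameter (LGroupData.gl F n)}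
    (hφ : φ.IsUnramified) {w w' : GaloisRepresentations.WeilGroup F}
    (hw : GaloisRepresentations.WeilGroup.deg w = 1) (hw' : GaloisRepresentations.WeilGroup.deg w' = 1) :
    (φ.φ w).left = (φ.φ w').left := by
  have hmul : GaloisRepresentations.IsFrobPow.mul (F := F) := GaloisRepresentations.IsFrobPow.mul_holds
  have huniq : GaloisRepresentations.IsFrobPow.unique (F := F) :=
    GaloisRepresentations.IsFrobPow.unique_holds
  have hu : w * w'⁻¹ ∈ GaloisRepresentations.WeilGroup.inertia F := by
    rw [← GaloisRepresentations.WeilGroup.deg_eq_zero_iff_mem_inertia hmul huniq,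
      GaloisRepresentations.WeilGroup.deg_mul hmul huniq,
      GaloisRepresentations.WeilGroup.deg_inv hmul huniq, hw, hw']
    ring
  have e : w = w * w'⁻¹ * w' := by group
  conv_lhs => rw [e]
  exact left_φ_inertia_mul_of_isUnramified hφ hu w'

/-- **An unramified L-parameter of `GL_n` is unramified with SOME multiset of Frobenius
eigenvalues**: `φ(w).left` (independent of the degree-`1` element `w`) is a semisimple element of
`GL_n(ℂ)` (Frobenius-semisimplicity, `isSemisimple_φ_of_gl`), hence diagonalisable over the
algebraically closed field `ℂ` (`IsSemisimpleElt.exists_conj_diagonal`, Springer LAG 2.4.2 (ii)).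
Ref: Borel, Corvallis 1979, §§8.2, 9.5, 10.4. [cite: Corvallis1979, §§8.2  9.5  10.4] -/
theorem exists_isUnramifiedWith_of_isUnramified {φ : LParameter (LGroupData.gl F n)}
    (hφ : φ.IsUnramified) : ∃ α : Multiset ℂ, φ.IsUnramifiedWith α := by
  classical
  by_cases hex : ∃ w₀ : GaloisRepresentations.WeilGroup F, GaloisRepresentations.WeilGroup.deg w₀ = 1
  · obtain ⟨w₀, hw₀⟩ := hex
    -- diagonalise the semisimple element `φ(w₀).left`
    have hss : IsSemisimpleElt ((φ.φ w₀).left : GL (Fin (LGroupData.gl F n).rank) ℂ) :=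
      isSemisimple_φ_of_gl φ w₀
    obtain ⟨P, dg, hP⟩ := hss.exists_conj_diagonal
    refine ⟨Multiset.map (fun i => (dg i : ℂ)) Finset.univ.val, hφ, fun w hw => ?_⟩
    refine ⟨P⁻¹, fun i => (dg i : ℂ), ?_, rfl⟩
    rw [left_φ_eq_of_deg_eq_one_of_isUnramified hφ hw hw₀]
    -- `φ(w₀) = P⁻¹ diag(d) P`
    have e : ((φ.φ w₀).left : GL (Fin (LGroupData.gl F n).rank) ℂ) = P⁻¹ * diagonalGL _ ℂ dg * P := by
      rw [← hP]; group
    rw [e, Units.val_mul, Units.val_mul, coe_diagonalGL, inv_inv]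
  · refine ⟨0, hφ, fun w hw => ?_⟩
    exact absurd ⟨w, hw⟩ hex

end LParameter

section Holds

variable {F : Type*} [Field F] [ValuativeRel F] [TopologicalSpace F] [IsNonarchimedeanLocalField F]

variable (F) in
/-- **Discharge of `isUnramified_iff_of_gl`** (lang.S14): for `GL_n`, an L-parameter `φ` is
unramified iff it is unramified with Frobenius eigenvalues `α` for some multiset `α` — unramified
parameters of `GL_n` are semisimple conjugacy classes in `GL_n(ℂ)`.  Forward:
`LParameter.exists_isUnramifiedWith_of_isUnramified` (Frobenius-semisimplicity +
diagonalisability of semisimple complex matrices); backward: `isUnramified_of_isUnramifiedWith`.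
Ref: Borel, Corvallis 1979, §§8.2, 9.5, 10.4; Gross–Reeder, Duke Math. J. 154 (2010), §3.1.
[cite: Corvallis1979, §§8.2  9.5  10.4] -/
theorem isUnramified_iff_of_gl_holds (n : ℕ) : isUnramified_iff_of_gl F n :=
  fun _ => ⟨LParameter.exists_isUnramifiedWith_of_isUnramified, isUnramified_of_isUnramifiedWith⟩

end Holds

end Literature.NumberTheory.Automorphic

end
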